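import Summits.QuantumFields.YangMills.Theorems.ColdStartUniversalityLatticeLangevinLawTransport
import Summits.QuantumFields.YangMills.Theorems.ColdStartUniversalityLatticeLangevinWellPosed
import Literature.Probability.Process.BrownianVecLaw
import HarnessLib

/-!
# Route `ColdStartUniversality` (rung input (E1) of crux K_A1, stmt-QuantumFields-24809): UNIQUENESS IN LAW
# of the cold-start SU(2) lattice Langevin dynamics — the stub `hyp_lawUnique` of
# `Cruxes/UniformColdStartMixing/Lines/rung_fixedCutoffMixing.lean` (v3) PROVED

Helper file (seat `ym-line-csu-p1`).  `coldStart_lawUnique`: any two cold-start solutions of the Shen–Zhu–Zhu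
system `latticeLangevinDynamics (fundamentalLatticeRep 2) β'` on `(ℤ/L)³`, on ANY two probability spaces (in
`Type`) carrying flat Brownian motions, have the same law at every lattice time.  Proof (Revuz–Yor IX §1,
«strong solutions are functionals of the driving path»): the path map `𝒲 : ω ↦ (t ↦ W_t ω)` sends `P` to a
measure `P ∘ 𝒲⁻¹` on the canonical space of continuous paths started at `0` which does not depend on the flat
Brownian motion (`map_pathMap_eq`, from the uniqueness of the law of a Brownian vector,
`Literature.Probability.Process.IsBrownianVec.map_vecPath_eq`); the coordinate process there is again a flat
Brownian motion (`isFlatBrownian_canonical`), so it carries a cold-start solution `Uc` (`solution_from_start`);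
`Uc ∘ 𝒲` solves the system on `Ω` (`isSolution_comp`), hence equals the given solution a.s.
(`latticeLangevin_pathwise_unique`), and `law(U_t) = (P ∘ 𝒲⁻¹) ∘ (Uc_t)⁻¹` is the same for all spaces.

With `latticeErgodic_of_lawUnique` / `fixedCutoffMixing_of_lawUnique` (…RungOfLawUnique) the rung
`stub_fixedCutoffMixing` is thereby reduced to the single analytic input (E3) (Cesàro ergodicity of one
cold-start solution).  No definition, no sorry.  RECORD-rung R3 plumbing; nothing here bears on the mass gap. -/

set_option autoImplicit false

noncomputable section

namespace Summit.QuantumFields.YangMills.Theorems.ColdStartUniversality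

open MeasureTheory ProbabilityTheory Filter Topology
open scoped NNReal ENNReal BigOperators
open Literature.Probability.Process Literature.Analysis.FunctionSpaces
open Literature.MathematicalPhysics.QuantumFieldTheory
open Literature.MathematicalPhysics.QuantumLattice (fundamentalRep fundamentalLatticeRep)

section Canonical

variable {Ω : Type*} {mΩ : MeasurableSpace Ω} {P : Measure Ω} {L : ℕ} [NeZero L]
  {W : ℝ≥0 → Ω → (Edge 3 L × NoiseIdx 2 → ℝ)}

/-- Paths of a flat Brownian motion are continuous and start at `0`. [folklore] -/
theorem continuous_path_and_zero (hW : IsFlatBrownian W P) (ω : Ω) :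
    Continuous (fun t => W t ω) ∧ W 0 ω = 0 := by
  refine ⟨continuous_pi fun i => continuous_flatCoord hW i ω, ?_⟩
  funext i
  have h := congrFun (IsBrownianVec.apply_zero hW ω) (Fintype.equivFin (Edge 3 L × NoiseIdx 2) i)
  simpa using h

/-- The path map into the canonical space of continuous paths started at `0` is measurable. [folklore] -/
theorem measurable_pathMap (hW : IsFlatBrownian W P) :
    Measurable (fun ω => (⟨fun t => W t ω, continuous_path_and_zero hW ω⟩ :
      {p : ℝ≥0 → (Edge 3 L × NoiseIdx 2 → ℝ) // Continuous p ∧ p 0 = 0})) :=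
  (measurable_pi_lambda _ fun t => hW.measurable t).subtype_mk

/-- Independence transfers to the image measure when both variables factor through the map. [folklore] -/
theorem indepFun_map_of_comp {S β γ : Type*} [MeasurableSpace S] [MeasurableSpace β] [MeasurableSpace γ]
    [IsProbabilityMeasure P] {φ : Ω → S} (hφ : Measurable φ) {f : S → β} {g : S → γ} (hf : Measurable f)
    (hg : Measurable g) (h : IndepFun (f ∘ φ) (g ∘ φ) P) : IndepFun f g (P.map φ) := by
  haveI : IsProbabilityMeasure (P.map φ) := Measure.isProbabilityMeasure_map hφ.aemeasurable
  rw [indepFun_iff_map_prod_eq_prod_map_map hf.aemeasurable hg.aemeasurable,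
    Measure.map_map (hf.prodMk hg) hφ, Measure.map_map hf hφ, Measure.map_map hg hφ]
  exact (indepFun_iff_map_prod_eq_prod_map_map (hf.comp hφ).aemeasurable (hg.comp hφ).aemeasurable).1 h

/-- **The coordinate process on the canonical space is a flat Brownian motion under the image of `P` by the
path map.** [folklore] -/
theorem isFlatBrownian_canonical [IsProbabilityMeasure P] (hW : IsFlatBrownian W P) :
    IsFlatBrownian (d := 3) (L := L) (κ := NoiseIdx 2)
      (fun (t : ℝ≥0) (p : {p : ℝ≥0 → (Edge 3 L × NoiseIdx 2 → ℝ) // Continuous p ∧ p 0 = 0}) => p.1 t)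
      (P.map (fun ω => (⟨fun t => W t ω, continuous_path_and_zero hW ω⟩ :
        {p : ℝ≥0 → (Edge 3 L × NoiseIdx 2 → ℝ) // Continuous p ∧ p 0 = 0}))) := by
  have hφ := measurable_pathMap hW
  -- measurability of the enumerated coordinate process on the canonical space
  have hmeas : ∀ t : ℝ≥0, Measurable (fun (p : {p : ℝ≥0 → (Edge 3 L × NoiseIdx 2 → ℝ) // Continuous p ∧ p 0 = 0})
      (k : Fin (Fintype.card (Edge 3 L × NoiseIdx 2))) => p.1 t ((Fintype.equivFin (Edge 3 L × NoiseIdx 2)).symm k)) :=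
    fun t => measurable_pi_lambda _ fun k =>
      (measurable_pi_apply _).comp ((measurable_pi_apply t).comp measurable_subtype_coe)
  refine ⟨hmeas, fun p => ?_, fun p => ?_, fun s => ?_, fun s => ?_, fun t => ?_⟩
  · exact continuous_pi fun k => (continuous_apply _).comp p.2.1
  · funext k
    simp [p.2.2]
  · -- independence of the shifted path and the past, transported from `W`
    refine indepFun_map_of_comp hφ (measurable_pi_lambda _ fun u => (hmeas (s + u)).sub (hmeas s))
      (measurable_pi_lambda _ fun r => hmeas r) ?_
    exact IsBrownianVec.indep_shift hW s
  · have hmS : Measurable (vecShift (fun (t : ℝ≥0)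
        (p : {p : ℝ≥0 → (Edge 3 L × NoiseIdx 2 → ℝ) // Continuous p ∧ p 0 = 0})
        (k : Fin (Fintype.card (Edge 3 L × NoiseIdx 2))) => p.1 t ((Fintype.equivFin (Edge 3 L × NoiseIdx 2)).symm k)) s) :=
      measurable_pi_lambda _ fun u => (hmeas (s + u)).sub (hmeas s)
    have hmP : Measurable (vecPath (fun (t : ℝ≥0)
        (p : {p : ℝ≥0 → (Edge 3 L × NoiseIdx 2 → ℝ) // Continuous p ∧ p 0 = 0})
        (k : Fin (Fintype.card (Edge 3 L × NoiseIdx 2))) => p.1 t ((Fintype.equivFin (Edge 3 L × NoiseIdx 2)).symm k))) :=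
      measurable_pi_lambda _ fun u => hmeas u
    change Measure.map (vecShift (fun (t : ℝ≥0)
        (p : {p : ℝ≥0 → (Edge 3 L × NoiseIdx 2 → ℝ) // Continuous p ∧ p 0 = 0})
        (k : Fin (Fintype.card (Edge 3 L × NoiseIdx 2))) => p.1 t ((Fintype.equivFin (Edge 3 L × NoiseIdx 2)).symm k)) s)
        (P.map (fun ω => (⟨fun t => W t ω, continuous_path_and_zero hW ω⟩ :
          {p : ℝ≥0 → (Edge 3 L × NoiseIdx 2 → ℝ) // Continuous p ∧ p 0 = 0}))) =
      Measure.map (vecPath (fun (t : ℝ≥0)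
        (p : {p : ℝ≥0 → (Edge 3 L × NoiseIdx 2 → ℝ) // Continuous p ∧ p 0 = 0})
        (k : Fin (Fintype.card (Edge 3 L × NoiseIdx 2))) => p.1 t ((Fintype.equivFin (Edge 3 L × NoiseIdx 2)).symm k)))
        (P.map (fun ω => (⟨fun t => W t ω, continuous_path_and_zero hW ω⟩ :
          {p : ℝ≥0 → (Edge 3 L × NoiseIdx 2 → ℝ) // Continuous p ∧ p 0 = 0})))
    rw [Measure.map_map hmS hφ, Measure.map_map hmP hφ]
    exact IsBrownianVec.map_shift hW s
  · rw [Measure.map_map (hmeas t) hφ]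
    exact IsBrownianVec.map_apply hW t

end Canonical

section Law

variable {L : ℕ} [NeZero L]

/-- **The image of `P` under the path map does not depend on the flat Brownian motion** (uniqueness of the law
of a Brownian vector, `IsBrownianVec.map_vecPath_eq`, read on the canonical subtype). [folklore] -/
theorem map_pathMap_eq {Ω : Type*} {mΩ : MeasurableSpace Ω} {P : Measure Ω} [IsProbabilityMeasure P]
    {W : ℝ≥0 → Ω → (Edge 3 L × NoiseIdx 2 → ℝ)} (hW : IsFlatBrownian W P)
    {Ω' : Type*} {mΩ' : MeasurableSpace Ω'} {P' : Measure Ω'} [IsProbabilityMeasure P']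
    {W' : ℝ≥0 → Ω' → (Edge 3 L × NoiseIdx 2 → ℝ)} (hW' : IsFlatBrownian W' P') :
    P.map (fun ω => (⟨fun t => W t ω, continuous_path_and_zero hW ω⟩ :
        {p : ℝ≥0 → (Edge 3 L × NoiseIdx 2 → ℝ) // Continuous p ∧ p 0 = 0})) =
      P'.map (fun ω => (⟨fun t => W' t ω, continuous_path_and_zero hW' ω⟩ :
        {p : ℝ≥0 → (Edge 3 L × NoiseIdx 2 → ℝ) // Continuous p ∧ p 0 = 0})) := by
  have hφ := measurable_pathMap hW
  have hφ' := measurable_pathMap hW'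
  -- the laws of the full paths agree (uniqueness of the law of a Brownian vector, reindexed)
  have hG : Measurable (fun (q : ℝ≥0 → Fin (Fintype.card (Edge 3 L × NoiseIdx 2)) → ℝ) (t : ℝ≥0)
      (i : Edge 3 L × NoiseIdx 2) => q t (Fintype.equivFin (Edge 3 L × NoiseIdx 2) i)) :=
    measurable_pi_lambda _ fun t => measurable_pi_lambda _ fun i =>
      (measurable_pi_apply _).comp (measurable_pi_apply t)
  have hpath : P.map (fun ω (t : ℝ≥0) => W t ω) = P'.map (fun ω (t : ℝ≥0) => W' t ω) := by
    have h1 : (fun ω (t : ℝ≥0) => W t ω) = (fun (q : ℝ≥0 → Fin (Fintype.card (Edge 3 L × NoiseIdx 2)) → ℝ)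
        (t : ℝ≥0) (i : Edge 3 L × NoiseIdx 2) => q t (Fintype.equivFin (Edge 3 L × NoiseIdx 2) i)) ∘
        vecPath (fun t ω k => W t ω ((Fintype.equivFin (Edge 3 L × NoiseIdx 2)).symm k)) := by
      funext ω t i
      simp [vecPath]
    have h2 : (fun ω (t : ℝ≥0) => W' t ω) = (fun (q : ℝ≥0 → Fin (Fintype.card (Edge 3 L × NoiseIdx 2)) → ℝ)
        (t : ℝ≥0) (i : Edge 3 L × NoiseIdx 2) => q t (Fintype.equivFin (Edge 3 L × NoiseIdx 2) i)) ∘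
        vecPath (fun t ω k => W' t ω ((Fintype.equivFin (Edge 3 L × NoiseIdx 2)).symm k)) := by
      funext ω t i
      simp [vecPath]
    rw [h1, h2, ← Measure.map_map hG (IsBrownianVec.measurable_vecPath hW),
      ← Measure.map_map hG (IsBrownianVec.measurable_vecPath hW'), IsBrownianVec.map_vecPath_eq hW hW']
  refine Measure.ext fun s hs => ?_
  obtain ⟨B, hB, rfl⟩ := MeasurableSpace.measurableSet_comap.1 hs
  rw [Measure.map_apply hφ hs, Measure.map_apply hφ' hs]
  have e1 : (fun ω => (⟨fun t => W t ω, continuous_path_and_zero hW ω⟩ :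
      {p : ℝ≥0 → (Edge 3 L × NoiseIdx 2 → ℝ) // Continuous p ∧ p 0 = 0})) ⁻¹' (Subtype.val ⁻¹' B) =
      (fun ω (t : ℝ≥0) => W t ω) ⁻¹' B := rfl
  have e2 : (fun ω => (⟨fun t => W' t ω, continuous_path_and_zero hW' ω⟩ :
      {p : ℝ≥0 → (Edge 3 L × NoiseIdx 2 → ℝ) // Continuous p ∧ p 0 = 0})) ⁻¹' (Subtype.val ⁻¹' B) =
      (fun ω (t : ℝ≥0) => W' t ω) ⁻¹' B := rfl
  rw [e1, e2, ← Measure.map_apply (measurable_pi_lambda _ fun t => hW.measurable t) hB,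
    ← Measure.map_apply (measurable_pi_lambda _ fun t => hW'.measurable t) hB, hpath]

/-- **(E1) UNIQUENESS IN LAW of cold-start solutions** — the stub `hyp_lawUnique` of the rung workfile
`Cruxes/UniformColdStartMixing/Lines/rung_fixedCutoffMixing.lean` (v3), verbatim: any two cold-start solutions of
the SU(2) SZZ dynamics on `(ℤ/L)³` at coupling `β'`, on any two probability spaces with flat Brownian drivers, have
the same one-time laws. [cite: RevuzYor1999, Ch. IX Thm (1.7) (pathwise uniqueness implies uniqueness in law)] -/
theorem coldStart_lawUnique : ∀ (L : ℕ) [NeZero L] (β' : ℝ)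
      (Ω : Type) (mΩ : MeasurableSpace Ω) (P : Measure Ω) (hP : IsProbabilityMeasure P)
      (W : ℝ≥0 → Ω → (Edge 3 L × NoiseIdx 2 → ℝ)) (hW : IsFlatBrownian W P)
      (U : ℝ≥0 → Ω → GaugeConfig 3 L (Matrix.specialUnitaryGroup (Fin 2) ℂ))
      (Ω' : Type) (mΩ' : MeasurableSpace Ω') (P' : Measure Ω') (hP' : IsProbabilityMeasure P')
      (W' : ℝ≥0 → Ω' → (Edge 3 L × NoiseIdx 2 → ℝ)) (hW' : IsFlatBrownian W' P')
      (U' : ℝ≥0 → Ω' → GaugeConfig 3 L (Matrix.specialUnitaryGroup (Fin 2) ℂ)),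
      (∀ ω, U 0 ω = fun _ => 1) →
      (latticeLangevinDynamics (fundamentalLatticeRep 2) β').IsSolution (fundamentalRep (Fin 2))
        hW.natFiltration P W U →
      (∀ ω, U' 0 ω = fun _ => 1) →
      (latticeLangevinDynamics (fundamentalLatticeRep 2) β').IsSolution (fundamentalRep (Fin 2))
        hW'.natFiltration P' W' U' →
      ∀ t : ℝ≥0, Measure.map (U t) P = Measure.map (U' t) P' := by
  intro L _ β' Ω mΩ P hP W hW U Ω' mΩ' P' hP' W' hW' U' hU0 hU hU'0 hU' t
  -- the canonical space, the two path maps, the common image measure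
  have hφ := measurable_pathMap hW
  have hφ' := measurable_pathMap hW'
  set Pc := P.map (fun ω => (⟨fun t => W t ω, continuous_path_and_zero hW ω⟩ :
      {p : ℝ≥0 → (Edge 3 L × NoiseIdx 2 → ℝ) // Continuous p ∧ p 0 = 0})) with hPc
  haveI hPcP : IsProbabilityMeasure Pc := Measure.isProbabilityMeasure_map hφ.aemeasurable
  have hWc := isFlatBrownian_canonical hW
  have hmap' : P'.map (fun ω => (⟨fun t => W' t ω, continuous_path_and_zero hW' ω⟩ :
      {p : ℝ≥0 → (Edge 3 L × NoiseIdx 2 → ℝ) // Continuous p ∧ p 0 = 0})) = Pc :=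
    (map_pathMap_eq hW hW').symm
  -- the canonical cold-start solution and its two pull-backs
  obtain ⟨Uc, hUc0, hUc⟩ := solution_from_start hWc β' (fun _ => 1)
  have hsol : (latticeLangevinDynamics (fundamentalLatticeRep 2) β').IsSolution (fundamentalRep (Fin 2))
      hW.natFiltration P W (fun s ω => Uc s ⟨fun t => W t ω, continuous_path_and_zero hW ω⟩) :=
    isSolution_comp hW hWc hφ rfl (fun _ _ => rfl) β' hUc
  have hsol' : (latticeLangevinDynamics (fundamentalLatticeRep 2) β').IsSolution (fundamentalRep (Fin 2))
      hW'.natFiltration P' W' (fun s ω => Uc s ⟨fun t => W' t ω, continuous_path_and_zero hW' ω⟩) :=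
    isSolution_comp hW' hWc hφ' hmap' (fun _ _ => rfl) β' hUc
  -- pathwise uniqueness on each space
  have hUeq := latticeLangevin_pathwise_unique hW β' (fun _ => 1) hU0 (fun ω => hUc0 _) hU hsol
  have hU'eq := latticeLangevin_pathwise_unique hW' β' (fun _ => 1) hU'0 (fun ω => hUc0 _) hU' hsol'
  have hmUc : Measurable (Uc t) := (hUc.adapted t).mono (hWc.natFiltration.le t) le_rfl
  calc Measure.map (U t) P
      = Measure.map (fun ω => Uc t ⟨fun t => W t ω, continuous_path_and_zero hW ω⟩) P :=
        Measure.map_congr (hUeq.mono fun ω hω => hω t)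
    _ = Pc.map (Uc t) := by rw [hPc, Measure.map_map hmUc hφ]; rfl
    _ = Measure.map (fun ω => Uc t ⟨fun t => W' t ω, continuous_path_and_zero hW' ω⟩) P' := by
        rw [← hmap', Measure.map_map hmUc hφ']; rfl
    _ = Measure.map (U' t) P' := Measure.map_congr (hU'eq.mono fun ω hω => (hω t).symm)

end Law

end Summit.QuantumFields.YangMills.Theorems.ColdStartUniversality

end
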